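import Literature.Probability.Percolation.RhombusPivotalSumAlt
import Literature.Probability.Percolation.AltFourArmGlue
import Literature.Probability.Percolation.FlipFourArm
import Literature.Probability.Percolation.WernerKestenRelationAlt
import HarnessLib

/-!
# `Werner2009_lemma62` from alternating separation, the alternating a priori bound, alternating stability and adjacent landing (proofs only)

Topic `Literature/Probability/Percolation`; family `crit-perc`. PROOFS ONLY (no definition, no
named fact). Assembly, for the named fact `Werner2009_lemma62` (`KestenRelationRusso.lean`;
W. Werner, *Lectures on two-dimensional critical percolation*, IAS/Park City Math. Ser. 16 (2009),
Lecture 6, Lemma 6.2 read for the rhombus `[0, N]²` as in P. Nolin, EJP 13 (2008), §7.3, proof of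
Prop. 34 and Remark 35 [arXiv 0711.4948: Prop. 32, Remark 34]), of the alternating route of
`KestenRelationRussoAlt.lean` / `RhombusPivotalSumAlt.lean` with two inputs the tree has meanwhile
PROVED:

* `altFourArm_quasiMult_of_altSeparation` (`AltFourArmGlue.lean`) — Werner's Cor. 6.2 for his
  alternating `π̂` from his Prop. 6.1 (alternating separation `(hsepA)`), Kesten's gluing landing
  in the alternating event by the Hex lemma;
* `fourArm_bridge_of_landing` (`FlipFourArm.lean`) — the comparison of the two arrangements of the
  order-free four-arm event at `p = 1/2` (Nolin 2008, Prop. 20 [arXiv Prop. 19]) from the LANDING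
  of the adjacent arrangement alone (`c · P_{1/2}(adjFourArm n N) ≤ P_{1/2}(landedFourAdj n N)`,
  Nolin's Thm. 11 for `σ = BBWW` at `p = 1/2`), Smirnov's colour switching being proved there.

Result: `Werner2009_lemma62_of_altSeparation_of_altLB_of_altStability_of_landing` —
**`Werner2009_lemma62` from four displayed statements**: (i) `(hsepA)` near-critical separation of
four ALTERNATING arms below `L(t, ε)` (Werner 2009, Prop. 6.1; Nolin 2008, Thm. 11, `j = 4`,
`σ = BWBW`); (ii) the a priori bound `c (m/n)^{2-β} ≤ π̂^alt_t(m, n)` below `L(p)` (Werner 2009,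
§3, third estimate, for his alternating `π̂`; Nolin's Thm. 24 (ii)); (iii) the alternating
Lemma 6.3, `π̂^alt_t(r₀, N) ≍ π̂^alt_{1/2}(r₀, N)` below `L(t, ε)` (Nolin's Thm. 27 for `j = 4`,
`σ = BWBW`); (iv) the landing of the adjacent arrangement at `p = 1/2` (Nolin's Thm. 11 for
`σ = BBWW`, critical case) — the last being the only input about the adjacent arrangement,
present because the fact's `π₄ = critFourArmProb` is order-free. Also the variant
`Werner2009_lemma62_of_altSeparation_of_altLB_of_altStability_of_bridge` with the uniform critical
bridge (Prop. 20 as printed) in place of (iv).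

## References

* W. Werner, *Lectures on two-dimensional critical percolation*, IAS/Park City Math. Ser. 16
  (2009), Lecture 6, §3, Prop. 6.1, Cor. 6.2, Lemma 6.2, Lemma 6.3 [arXiv 0710.0856, pp. 44–48]
  [WernerPCMI2009].
* P. Nolin, Near-critical percolation in two dimensions, *Electron. J. Probab.* 13 (2008)
  1562–1623, Thm. 11, Prop. 17, §5.1 Prop. 20, Thm. 24, Thm. 27, §7.3 Prop. 34 and Remark 35
  (arXiv 0711.4948: Thm. 10, Prop. 16, Prop. 19, Thm. 23, Thm. 26, Prop. 32, Remark 34) [Nolin2008].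
* H. Kesten, Scaling relations for 2D-percolation, *Comm. Math. Phys.* 109 (1987) 109–156
  [KestenScalingCMP1987].

Tree: `Werner2009_lemma62_of_altSeparation_of_altHyps` (`RhombusPivotalSumAlt.lean`),
`altFourArm_quasiMult_of_altSeparation` (`AltFourArmGlue.lean`), `fourArm_bridge_of_landing`
(`FlipFourArm.lean`), `fixedRadiusBridge_of_bridge` (`WernerKestenRelationAlt.lean`),
`altFourArmProbAt`, `adjFourArm`, `landedFourAdj`, `sepFourArm`, `charLengthW`, `critFourArmProb`.
-/

noncomputable section

open MeasureTheory Set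
open scoped unitInterval

namespace Literature.Probability.Percolation

open LatticeModels

/-- **`Werner2009_lemma62` from alternating separation, the alternating a priori bound, alternating
four-arm stability and the uniform critical bridge.** `Werner2009_lemma62_of_altSeparation_of_altHyps`
with the quasi-multiplicativity of `π̂^alt` supplied by `altFourArm_quasiMult_of_altSeparation`
(Werner's Cor. 6.2 from Prop. 6.1, both for the alternating `π̂`) and the fixed-radius bridge by
the uniform one (`fixedRadiusBridge_of_bridge`; Nolin 2008, Prop. 20 for `j = 4`). [cite: WernerPCMI2009, Lecture 6, Prop. 6.1, Cor. 6.2, §3, Lemma 6.2, Lemma 6.3] [cite: Nolin2008, Thm. 11, Prop. 17, §5.1 Prop. 20, Thm. 24, Thm. 27, §7.3 Prop. 34 and Remark 35 (arXiv 0711.4948: Thm. 10, Prop. 16, Prop. 19, Thm. 23, Thm. 26, Prop. 32, Remark 34)] -/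
theorem Werner2009_lemma62_of_altSeparation_of_altLB_of_altStability_of_bridge
    (hsepA : ∃ ε₁ > (0 : ℝ), ∀ ⦃ε : ℝ⦄, 0 < ε → ε < ε₁ →
      ∃ n₀ : ℕ, ∃ δ > (0 : ℝ), ∃ c > (0 : ℝ),
        ∀ t : unitInterval, 1 / 2 ≤ (t : ℝ) → (t : ℝ) < 1 / 2 + δ →
          ∀ n N : ℕ, n₀ ≤ n → 2 * n ≤ N → (1 / 2 < (t : ℝ) → N ≤ charLengthW ε t) →
            c * altFourArmProbAt t n N ≤ (triSitePercolation t).real (sepFourArm n N))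
    (hLB : ∃ ε₁ > (0 : ℝ), ∀ ⦃ε : ℝ⦄, 0 < ε → ε < ε₁ →
      ∃ r₁ : ℕ, ∃ δ > (0 : ℝ), ∃ β > (0 : ℝ), ∃ c > (0 : ℝ),
        ∀ t : unitInterval, 1 / 2 ≤ (t : ℝ) → (t : ℝ) < 1 / 2 + δ →
          ∀ m n : ℕ, r₁ ≤ m → m ≤ n → (1 / 2 < (t : ℝ) → n ≤ charLengthW ε t) →
            c * ((m : ℝ) / n) ^ (2 - β) ≤ altFourArmProbAt t m n)
    (hS : ∃ ε₁ > (0 : ℝ), ∀ ⦃ε : ℝ⦄, 0 < ε → ε < ε₁ →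
      ∃ r₁ : ℕ, ∀ r₀ ≥ r₁, ∃ n₁ : ℕ, ∃ δ > (0 : ℝ), ∃ c > (0 : ℝ), ∃ C : ℝ,
        ∀ t : unitInterval, 1 / 2 ≤ (t : ℝ) → (t : ℝ) < 1 / 2 + δ →
          ∀ N : ℕ, n₁ ≤ N → (1 / 2 < (t : ℝ) → N ≤ charLengthW ε t) →
            c * altFourArmProbAt half r₀ N ≤ altFourArmProbAt t r₀ N ∧
              altFourArmProbAt t r₀ N ≤ C * altFourArmProbAt half r₀ N)
    (hBr : ∃ c : ℝ, 0 < c ∧ ∃ n₀ : ℕ, ∀ n N : ℕ, n₀ ≤ n → 2 * n ≤ N →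
      c * critFourArmProb n N ≤ (triSitePercolation half).real (altFourArm n N)) :
    Werner2009_lemma62 :=
  Werner2009_lemma62_of_altSeparation_of_altHyps hsepA (altFourArm_quasiMult_of_altSeparation hsepA)
    hLB hS (fixedRadiusBridge_of_bridge hBr)

/-- **`Werner2009_lemma62` from alternating separation, the alternating a priori bound, alternating
four-arm stability and the landing of the adjacent arrangement at `p = 1/2`.** The bridge of the
previous theorem is `fourArm_bridge_of_landing` (`FlipFourArm.lean`: Nolin's Prop. 20 for four arms
from the landing `c · P_{1/2}(adjFourArm n N) ≤ P_{1/2}(landedFourAdj n N)`, Nolin's Thm. 11 for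
`σ = BBWW` at `p = 1/2`, and Smirnov's colour switching, proved there). After this theorem the
inputs of `Werner2009_lemma62_holds` are: Nolin's Thm. 11 for `j = 4` (alternating arrangement
below `L(p)`, adjacent arrangement at `p = 1/2`), Thm. 24 (ii) and Thm. 27 for the alternating
arrangement. [cite: WernerPCMI2009, Lecture 6, Prop. 6.1, Cor. 6.2, §3, Lemma 6.2, Lemma 6.3] [cite: Nolin2008, Thm. 11, §5.1 Prop. 20, Thm. 24, Thm. 27, §7.3 Prop. 34 and Remark 35 (arXiv 0711.4948: Thm. 10, Prop. 19, Thm. 23, Thm. 26, Prop. 32, Remark 34)] [cite: BollobasRiordan2006, Ch. 7 Lemma 6] -/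
theorem Werner2009_lemma62_of_altSeparation_of_altLB_of_altStability_of_landing
    (hsepA : ∃ ε₁ > (0 : ℝ), ∀ ⦃ε : ℝ⦄, 0 < ε → ε < ε₁ →
      ∃ n₀ : ℕ, ∃ δ > (0 : ℝ), ∃ c > (0 : ℝ),
        ∀ t : unitInterval, 1 / 2 ≤ (t : ℝ) → (t : ℝ) < 1 / 2 + δ →
          ∀ n N : ℕ, n₀ ≤ n → 2 * n ≤ N → (1 / 2 < (t : ℝ) → N ≤ charLengthW ε t) →
            c * altFourArmProbAt t n N ≤ (triSitePercolation t).real (sepFourArm n N))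
    (hLB : ∃ ε₁ > (0 : ℝ), ∀ ⦃ε : ℝ⦄, 0 < ε → ε < ε₁ →
      ∃ r₁ : ℕ, ∃ δ > (0 : ℝ), ∃ β > (0 : ℝ), ∃ c > (0 : ℝ),
        ∀ t : unitInterval, 1 / 2 ≤ (t : ℝ) → (t : ℝ) < 1 / 2 + δ →
          ∀ m n : ℕ, r₁ ≤ m → m ≤ n → (1 / 2 < (t : ℝ) → n ≤ charLengthW ε t) →
            c * ((m : ℝ) / n) ^ (2 - β) ≤ altFourArmProbAt t m n)
    (hS : ∃ ε₁ > (0 : ℝ), ∀ ⦃ε : ℝ⦄, 0 < ε → ε < ε₁ →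
      ∃ r₁ : ℕ, ∀ r₀ ≥ r₁, ∃ n₁ : ℕ, ∃ δ > (0 : ℝ), ∃ c > (0 : ℝ), ∃ C : ℝ,
        ∀ t : unitInterval, 1 / 2 ≤ (t : ℝ) → (t : ℝ) < 1 / 2 + δ →
          ∀ N : ℕ, n₁ ≤ N → (1 / 2 < (t : ℝ) → N ≤ charLengthW ε t) →
            c * altFourArmProbAt half r₀ N ≤ altFourArmProbAt t r₀ N ∧
              altFourArmProbAt t r₀ N ≤ C * altFourArmProbAt half r₀ N)
    (hLand : ∃ c : ℝ, 0 < c ∧ ∃ n₀ : ℕ, ∀ n N : ℕ, n₀ ≤ n → 2 * n ≤ N →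
      c * (triSitePercolation half).real (adjFourArm n N) ≤
        (triSitePercolation half).real (landedFourAdj n N)) :
    Werner2009_lemma62 :=
  Werner2009_lemma62_of_altSeparation_of_altLB_of_altStability_of_bridge hsepA hLB hS
    (fourArm_bridge_of_landing hLand)

end Literature.Probability.Percolation

end
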